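import Summits.HubbardSuperconductivity.HubbardSuperconductivity.Theorems.BirGroundStateAverageLRO.Negative.PairingCost
import Literature.MathematicalPhysics.QuantumLattice.HubbardPairDensityCouplingCeilingUniform

/-!
# Crux `BirGroundStateAverageLRO` (item `stmt-HubbardSuperconductivity-2079`): the window ceiling with an ABSOLUTE constant

The crux (`Theses.BalabanIR.BirGroundStateAverageLRO`, route BalabanIR, target / rank 0) asks, on a
window of couplings `0 < U₁ < U < U₂`, eventually in even `L`, the ground-state-AVERAGE `d`-wave pair
LRO `c·L⁴·Re tr P ≤ Re tr (P Δ_d† Δ_d)` for the projection `P` onto the ground eigenspace of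
`hubbardTorus 2 L 1 U` in the sector `(2⌊(1-δ)L²/2⌋, S^z = 0)`, at a doping `δ ∈ (0, 1/2)`.

`Negative/PairingCostLog.lean` charged the pairing at the Bardeen–Cooper–Schrieffer rate using the
crux's own doping `δ > 0` and EVEN `L` (Fermi level off the van Hove level), with the constant
`16384/δ`. The filling-uniform rate of `Literature/…/FreeFermiGasPairingCostUniform.lean` (van-Hove-safe
level counting: `TorusShellCountLog`, `TorusInverseGapSumLog`) removes every such hypothesis at the
price of one logarithm (negative side only; nothing asserts a Theses decl; every mutated statement is
spelled out):

* `avgBound_coupling_floor_uniform` — POINTWISE: the crux's inequality at ONE datum `(δ, U, c, L)`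
  with `δ ≥ -1` (ANY filling of the crux's shape), `U ≥ 0`, `c > 0`, ANY side `L ≥ ⌈3200/√c⌉ + 3`
  (no parity) forces `c/(10⁵·log²(4 + 32/√c)) ≤ U`;
* `birGroundStateAverageLRO_window_floor_uniform` / `…_witness_floor_uniform` — every witness
  `(δ, U₁, U₂, c)` of the crux, indeed of its weakening with `δ ≥ -1` and `0 ≤ U₁`, satisfies
  `c/(10⁵·log²(4 + 32/√c)) ≤ U₁`;
* `birGroundStateAverageLRO_witness_ceiling_uniform` — CLOSED FORM with an absolute constant:
  **`c ≤ 10⁵·U₁·log²(4 + 32/√U₁)`** (was `(16384/δ)·U₁·log(4 + 32/√U₁)`);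
  `not_avgBound_window_of_uniform_ceiling_lt` — the same read as a regime map.

Regime map for the planners / the standing disprover: an engine for the crux must output
`c(U₁) ≤ 10⁵ U₁ log²(4 + 32/√U₁)` WHATEVER the doping (including `δ → 0`, where the doped ceiling
degenerates); the expected truth is `e^{-O(1/U)}`-small (`PerturbativeInvisibilityOfPairing`). This closes
the a-priori side of the crux in its final elementary form: first-order kinetic budget `U·L²` against the
pairing cost at the level-uniform BCS–van Hove rate; any further sharpening needs a second-order kinetic
budget (correlation-energy bounds), not a better pairing inequality or level count.

Sources: Bardeen–Cooper–Schrieffer, Phys. Rev. 108 (1957) 1175, §II–III; L. Van Hove, Phys. Rev. 89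
(1953) 1189; C. N. Yang, Rev. Mod. Phys. 34 (1962) 694, §3; Tasaki (2020) §2.2 (variational
principle). Folklore finite-dimensional statements; no named facts, no definitions.
-/

noncomputable section

namespace Summit.HubbardSuperconductivity.HubbardSuperconductivity.Theorems.BirGroundStateAverageLRO.Negative

open Matrix Finset Filter
open Literature.Probability.LatticeModels Literature.MathematicalPhysics.QuantumLattice
open Summit.HubbardSuperconductivity.HubbardSuperconductivity.Theorems
open scoped ComplexOrder

/-- **Pointwise coupling floor, every filling and parity.** If the crux's ground-state-average bound
`c·L⁴·Re tr P ≤ Re tr (P Δ_d†Δ_d)` holds at ONE datum `(δ, U, c, L)` with `δ ≥ -1`, `U ≥ 0`, `c > 0`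
and `L ≥ ⌈3200/√c⌉ + 3`, then `c/(10⁵·log²(4 + 32/√c)) ≤ U`: a sector ground state carrying the bound
(`exists_groundState_le_of_trace_bound`) obeys the filling-uniform coupling floor
`hubbardTorus_groundState_pairLRO_coupling_floor_uniform`. [folklore] -/
theorem avgBound_coupling_floor_uniform (L : ℕ) [NeZero L] {δ U c : ℝ} (hδ : -1 ≤ δ)
    (hU : 0 ≤ U) (hc : 0 < c) (hL : ⌈3200 / Real.sqrt c⌉₊ + 3 ≤ L)
    (h : let N : ℕ := 2 * ⌊(1 - δ) * (L : ℝ) ^ 2 / 2⌋₊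
      let H := hubbardTorus 2 L 1 U
      let S := szSector (Λ := FermionTorus 2 L) N 0
      let E₀ := S ⊓ Module.End.eigenspace (Matrix.toLin' H) ((H.minEnergyOn S : ℝ) : ℂ)
      let P := projMatrix (E₀.map (Fock.toEuclidean (ι := Orb (FermionTorus 2 L)) :
        Fock (Orb (FermionTorus 2 L)) →ₗ[ℂ] EuclideanSpace ℂ (Finset (Orb (FermionTorus 2 L)))))
      c * (L : ℝ) ^ 4 * P.trace.re ≤
        (P * ((pairField dWaveFormFactor L)ᴴ * pairField dWaveFormFactor L)).trace.re) :
    c / (100000 * Real.log (4 + 32 / Real.sqrt c) ^ 2) ≤ U := by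
  obtain ⟨ψ, hgs, h1, hle⟩ := exists_groundState_le_of_trace_bound L 1 U δ c hδ h
  have hn := NoGo.floor_pairNumber_le δ hδ L
  exact hubbardTorus_groundState_pairLRO_coupling_floor_uniform hc hU hL hn hgs h1 hle

/-- **Window floor for `BirGroundStateAverageLRO`, every filling.** If the crux's average bound with
constant `c > 0` holds eventually in even `L` at every coupling of an interval `(U₁, U₂)`, `0 ≤ U₁ < U₂`
(any `δ ≥ -1`), then `c/(10⁵·log²(4 + 32/√c)) ≤ U₁` (pick a coupling of the window below the rate and a
large even side; the pointwise floor contradicts it). [folklore] -/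
theorem birGroundStateAverageLRO_window_floor_uniform {δ U₁ U₂ c : ℝ}
    (hδ : -1 ≤ δ) (hU₁ : 0 ≤ U₁) (hU : U₁ < U₂) (hc : 0 < c)
    (h : ∀ U ∈ Set.Ioo U₁ U₂, ∃ L₀ : ℕ, ∀ (L : ℕ) [NeZero L], L₀ ≤ L → Even L →
      let N : ℕ := 2 * ⌊(1 - δ) * (L : ℝ) ^ 2 / 2⌋₊
      let H := hubbardTorus 2 L 1 U
      let S := szSector (Λ := FermionTorus 2 L) N 0
      let E₀ := S ⊓ Module.End.eigenspace (Matrix.toLin' H) ((H.minEnergyOn S : ℝ) : ℂ)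
      let P := projMatrix (E₀.map (Fock.toEuclidean (ι := Orb (FermionTorus 2 L)) :
        Fock (Orb (FermionTorus 2 L)) →ₗ[ℂ] EuclideanSpace ℂ (Finset (Orb (FermionTorus 2 L)))))
      c * (L : ℝ) ^ 4 * P.trace.re ≤
        (P * ((pairField dWaveFormFactor L)ᴴ * pairField dWaveFormFactor L)).trace.re) :
    c / (100000 * Real.log (4 + 32 / Real.sqrt c) ^ 2) ≤ U₁ := by
  by_contra hlt
  push Not at hlt
  set η : ℝ := c / (100000 * Real.log (4 + 32 / Real.sqrt c) ^ 2) with hη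
  set U := min ((U₁ + η) / 2) ((U₁ + U₂) / 2) with hUdef
  have hUmem : U ∈ Set.Ioo U₁ U₂ := by
    constructor
    · simp only [hUdef, lt_min_iff]; constructor <;> linarith
    · exact (min_le_right _ _).trans_lt (by linarith)
  have hUη : U < η := (min_le_left _ _).trans_lt (by linarith)
  have hU0 : 0 ≤ U := le_trans hU₁ hUmem.1.le
  obtain ⟨L₀, hL₀⟩ := h U hUmem
  set m := max L₀ (⌈3200 / Real.sqrt c⌉₊ + 3) + 1 with hm
  haveI : NeZero (2 * m) := ⟨by omega⟩
  have hbound := hL₀ (2 * m) (by omega) (even_two_mul m)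
  have hfl := avgBound_coupling_floor_uniform (2 * m) hδ hU0 hc (by omega) hbound
  rw [← hη] at hfl
  linarith

/-- **Corollary for the crux itself, every filling.** Any witness `(δ, U₁, U₂, c)` of
`BirGroundStateAverageLRO` (with its `δ ∈ (0,1/2)`, `0 < U₁`) has `c/(10⁵·log²(4 + 32/√c)) ≤ U₁`.
[folklore] -/
theorem birGroundStateAverageLRO_witness_floor_uniform {δ U₁ U₂ c : ℝ}
    (hδ : δ ∈ Set.Ioo (0:ℝ) (1/2)) (hU₁ : 0 < U₁) (hU : U₁ < U₂) (hc : 0 < c)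
    (h : ∀ U ∈ Set.Ioo U₁ U₂, ∃ L₀ : ℕ, ∀ (L : ℕ) [NeZero L], L₀ ≤ L → Even L →
      let N : ℕ := 2 * ⌊(1 - δ) * (L : ℝ) ^ 2 / 2⌋₊
      let H := hubbardTorus 2 L 1 U
      let S := szSector (Λ := FermionTorus 2 L) N 0
      let E₀ := S ⊓ Module.End.eigenspace (Matrix.toLin' H) ((H.minEnergyOn S : ℝ) : ℂ)
      let P := projMatrix (E₀.map (Fock.toEuclidean (ι := Orb (FermionTorus 2 L)) :
        Fock (Orb (FermionTorus 2 L)) →ₗ[ℂ] EuclideanSpace ℂ (Finset (Orb (FermionTorus 2 L)))))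
      c * (L : ℝ) ^ 4 * P.trace.re ≤
        (P * ((pairField dWaveFormFactor L)ᴴ * pairField dWaveFormFactor L)).trace.re) :
    c / (100000 * Real.log (4 + 32 / Real.sqrt c) ^ 2) ≤ U₁ :=
  birGroundStateAverageLRO_window_floor_uniform (by linarith [hδ.1]) hU₁.le hU hc h

/-- **Closed form of the witness ceiling with an absolute constant.** Every witness `(δ, U₁, U₂, c)` of
`BirGroundStateAverageLRO` has `c ≤ 10⁵ · U₁ · log²(4 + 32/√U₁)`: the admissible LRO constant is
`O(U₁ log²(1/U₁))` in the lower edge of its window, with NO dependence on the doping (inversion of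
`birGroundStateAverageLRO_witness_floor_uniform` by `le_mul_log_sq_of_le_mul_log_sq_sqrt_self'`). Compare
`birGroundStateAverageLRO_witness_ceiling_log`: `(16384/δ)·U₁·log(4 + 32/√U₁)`. [folklore] -/
theorem birGroundStateAverageLRO_witness_ceiling_uniform {δ U₁ U₂ c : ℝ}
    (hδ : δ ∈ Set.Ioo (0:ℝ) (1/2)) (hU₁ : 0 < U₁) (hU : U₁ < U₂) (hc : 0 < c)
    (h : ∀ U ∈ Set.Ioo U₁ U₂, ∃ L₀ : ℕ, ∀ (L : ℕ) [NeZero L], L₀ ≤ L → Even L →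
      let N : ℕ := 2 * ⌊(1 - δ) * (L : ℝ) ^ 2 / 2⌋₊
      let H := hubbardTorus 2 L 1 U
      let S := szSector (Λ := FermionTorus 2 L) N 0
      let E₀ := S ⊓ Module.End.eigenspace (Matrix.toLin' H) ((H.minEnergyOn S : ℝ) : ℂ)
      let P := projMatrix (E₀.map (Fock.toEuclidean (ι := Orb (FermionTorus 2 L)) :
        Fock (Orb (FermionTorus 2 L)) →ₗ[ℂ] EuclideanSpace ℂ (Finset (Orb (FermionTorus 2 L)))))
      c * (L : ℝ) ^ 4 * P.trace.re ≤
        (P * ((pairField dWaveFormFactor L)ᴴ * pairField dWaveFormFactor L)).trace.re) :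
    c ≤ 100000 * U₁ * Real.log (4 + 32 / Real.sqrt U₁) ^ 2 := by
  have hfl := birGroundStateAverageLRO_witness_floor_uniform hδ hU₁ hU hc h
  have hlog : 0 < Real.log (4 + 32 / Real.sqrt c) ^ 2 := by
    have := one_le_log_four_add_div_sqrt c
    positivity
  have himp : c ≤ 100000 * U₁ * Real.log (4 + 32 / Real.sqrt c) ^ 2 := by
    rw [div_le_iff₀ (by positivity)] at hfl
    linarith
  exact le_mul_log_sq_of_le_mul_log_sq_sqrt_self' hc (by norm_num) hU₁ himp

/-- **The uniform ceiling read as a regime map.** If `10⁵·U₁·log²(4 + 32/√U₁) < c` (with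
`δ ∈ (0,1/2)`, `0 < U₁ < U₂`, `0 < c`) then `(δ, U₁, U₂, c)` is NOT a witness of the crux — at any
doping: on a window with lower edge `U₁` the crux can hold only with an LRO constant below the
doping-free closed-form ceiling. [folklore] -/
theorem not_avgBound_window_of_uniform_ceiling_lt {δ U₁ U₂ c : ℝ}
    (hδ : δ ∈ Set.Ioo (0:ℝ) (1/2)) (hU₁ : 0 < U₁) (hU : U₁ < U₂) (hc : 0 < c)
    (hlt : 100000 * U₁ * Real.log (4 + 32 / Real.sqrt U₁) ^ 2 < c) :
    ¬ (∀ U ∈ Set.Ioo U₁ U₂, ∃ L₀ : ℕ, ∀ (L : ℕ) [NeZero L], L₀ ≤ L → Even L →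
      let N : ℕ := 2 * ⌊(1 - δ) * (L : ℝ) ^ 2 / 2⌋₊
      let H := hubbardTorus 2 L 1 U
      let S := szSector (Λ := FermionTorus 2 L) N 0
      let E₀ := S ⊓ Module.End.eigenspace (Matrix.toLin' H) ((H.minEnergyOn S : ℝ) : ℂ)
      let P := projMatrix (E₀.map (Fock.toEuclidean (ι := Orb (FermionTorus 2 L)) :
        Fock (Orb (FermionTorus 2 L)) →ₗ[ℂ] EuclideanSpace ℂ (Finset (Orb (FermionTorus 2 L)))))
      c * (L : ℝ) ^ 4 * P.trace.re ≤
        (P * ((pairField dWaveFormFactor L)ᴴ * pairField dWaveFormFactor L)).trace.re) := by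
  intro h
  have := birGroundStateAverageLRO_witness_ceiling_uniform hδ hU₁ hU hc h
  linarith

end Summit.HubbardSuperconductivity.HubbardSuperconductivity.Theorems.BirGroundStateAverageLRO.Negative
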